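import Literature.IUT.LogVolume.DifferentConductorTower
import Literature.IUT.LogVolume.Theorem110StepII
import HarnessLib

/-!
# [IUTchIV] Theorem 1.10, Step (ii), for REAL towers of number fields, II: the second and third displays
# with the printed constants `log(2^11·3^3·5^2)` and `2·log(l)`

Mochizuki, *Inter-universal Teichmüller theory IV*, RIMS manuscript (Apr. 2020; = PRIMS **57** (2021)),
Theorem 1.10, proof Step (ii), p. 24 (kurims `paper:url-56bcb0f95768`, read on the page):

> "the inequality `log(𝔡^F) + log(𝔣^F) ≤ log(𝔡^{F_tpd}) + log(𝔣^{F_tpd}) + log(2^11·3^3·5^2)` follows by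
> applying Proposition 1.3, (i), at the primes that do not divide `2·3·5` [where we recall that the extension
> `F/F_tpd` is tamely ramified over such primes — cf. Proposition 1.8, (vi), (vii)] and applying Proposition
> 1.3, (ii), together with (E3), (E4), (E5), (E6), and the fact that we have a natural outer inclusion
> `Gal(F/F_tpd) ↪ GL_2(𝔽_3) × GL_2(𝔽_5) × ℤ/2ℤ`, at the primes that divide `2·3·5`. In a similar vein, since the
> extension `K/F` is tamely ramified at the primes that do not divide `l`, and we have a natural outer inclusion
> `Gal(K/F) ↪ GL_2(𝔽_l)`, the inequality `log(𝔡^K) ≤ log(𝔡^K) + log(𝔣^K) ≤ log(𝔡^F) + log(𝔣^F) + 2·log(l)`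
> follows immediately from Proposition 1.3, (i), (ii)."

Sequel of `DifferentConductorTower.lean` (setting, vocabulary and the unconditional first display there:
number fields `F ⊆ K`, bad places `S` of `F`, `T` the places of `K` over `S` (`hT`), `𝔡^L_ADiv =
differentDivisor L`, `𝔣^L_ADiv = ADivisor.reduced`, `deg = ndeg`). PROVED here, for ACTUAL number fields:

* `degF_relDifferent_add_reduced_le`, `ndeg_different_add_reduced_le` — **second display, general form**: if
  `K/F` is unramified at the good places and tamely ramified at the bad places of residue characteristic
  `∉ P` (the inputs the printed proof takes from Prop. 1.8 (vi), (vii) / (D0)), and `ord_w 𝔡_{K/F} ≤ c(p)·e(w|p)`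
  at the places over `p ∈ P`, then `deg(𝔡^K) + deg(𝔣^K) ≤ deg(𝔡^F) + deg(𝔣^F) + Σ_{p∈P} c(p)·log p` — at a
  tame bad place the relative different `ord_w 𝔡_{K/F} = e(w|v) - 1` (Neukirch III (2.6)) EXACTLY compensates
  the conductor's loss, at an unramified good place `ord_w 𝔡_{K/F} = 0`, and over `p ∈ P` the fundamental
  identity `Σ_{w|p} e(w|p) f(w|p) = [K:ℚ]` turns `c(p)·e(w|p)·log N(w)` into `[K:ℚ]·c(p)·log p`;
* `ndeg_different_add_reduced_le_of_isGalois` — **Galois form**: `K/F` Galois with `[K:F] ∣ N`,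
  `v_p(N) ≤ m(p)` on `P` ⟹ constant `Σ_{p∈P} (m(p)+1)·log p`, from the relative form of Prop. 1.3 (ii)
  (Dedekind–Hensel `ord_w 𝔡_{K/F} < e(w|p)·(v_p(N)+1)`, `RelativeDifferentExponents`);
* `ndeg_different_add_reduced_le_F` — `[K:F] ∣ 2^10·3^2·5 = |GL₂(𝔽₃)|·|GL₂(𝔽₅)|·2` ((E3), (E4)) ⟹ the
  printed **`log(2^11·3^3·5^2)`** (`Thm110StepII.PlaceData.log_F_const`) = `ProofData.F_le` for actual fields;
* `ndeg_different_add_reduced_le_K` — `[K:F] ∣ l(l+1)(l-1)² = |GL₂(𝔽_l)|`, `l ≥ 5` prime ⟹ the printed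
  **`2·log(l)`** (`Thm110StepII.PlaceData.GL2_card_l_part`) = `ProofData.K_le` for actual fields.

What remains HYPOTHESIS is exactly what the printed proof takes from elsewhere: the tame/unramified behaviour
(Prop. 1.8 (vi)(vii), (D0), semi-stable reduction) and the Galois groups of `F/F_tpd`, `K/F` (torsion fields
of the elliptic curve). No log-volume computation and no statement of [IUTchIII] is involved; nothing here
takes a side on Cor. 3.12; classical algebraic number theory kernel-checked, the [IUTchIV] locators
recording what it instantiates.
-/

noncomputable section

namespace Literature.IUT.LogVolume

open NumberField IsDedekindDomain Finset
open Literature.NumberTheory.NumberFields (multiplicity_differentIdeal_le_of_not_dvd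
  multiplicity_differentIdeal_eq_zero_of_ramificationIdx_eq_one multiplicity_differentIdeal_lt_of_isGalois)
open scoped Classical

variable (F K : Type*) [Field F] [NumberField F] [Field K] [NumberField K] [Algebra F K]

/-! ### Step (ii), second display: tame/unramified outside `P`, a bound of Prop. 1.3 (ii)-type over `P` -/

section SecondDisplay

/-- The key estimate behind the second display, unnormalised. Hypotheses, for every finite place `w` of `K`
with residue characteristic `p_w` and `v = w ∩ 𝓞 F`: if `p_w ∉ P` and `v ∉ S` (good) then `w/v` is unramified
(`e(w|v) = 1`); if `p_w ∉ P` and `v ∈ S` (bad) then `w/v` is tamely ramified (`p_w ∤ e(w|v)`); if `p_w ∈ P` then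
`ord_w 𝔡_{K/F} ≤ c(p_w)·e(w|p_w)`. Conclusion:
`deg_K(𝔡_{K/F}) + deg_K(𝔣^K) ≤ [K:F]·deg_F(𝔣^F) + [K:ℚ]·Σ_{p ∈ P} c(p)·log p`
(tame: `ord_w 𝔡_{K/F} = e(w|v) - 1` is exactly the conductor's loss; unramified: `ord_w = 0`; over `p ∈ P`:
`Σ_{w | p} e(w|p) f(w|p) = [K:ℚ]`). [claim: Mochizuki2012, status: disputed] -/
theorem degF_relDifferent_add_reduced_le (S : Finset (HeightOneSpectrum (𝓞 F)))
    (T : Finset (HeightOneSpectrum (𝓞 K))) (hT : ∀ w, w ∈ T ↔ finBelow F K w ∈ S)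
    (P : Finset ℕ) (hP : ∀ p ∈ P, p.Prime) (c : ℕ → ℕ)
    (hunr : ∀ w : HeightOneSpectrum (𝓞 K), residueChar K w ∉ P → finBelow F K w ∉ S →
      w.asIdeal.ramificationIdx (𝓞 F) = 1)
    (htame : ∀ w : HeightOneSpectrum (𝓞 K), residueChar K w ∉ P → finBelow F K w ∈ S →
      ¬ residueChar K w ∣ w.asIdeal.ramificationIdx (𝓞 F))
    (hbd : ∀ w : HeightOneSpectrum (𝓞 K), residueChar K w ∈ P →
      multiplicity w.asIdeal (differentIdeal (𝓞 F) (𝓞 K)) ≤ c (residueChar K w) * w.asIdeal.ramificationIdx ℤ) :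
    degF K (relDifferentDivisor F K) + degF K (ADivisor.reduced T) ≤
      (Module.finrank F K : ℝ) * degF F (ADivisor.reduced S) +
        (Module.finrank ℚ K : ℝ) * ∑ p ∈ P, (c p : ℝ) * Real.log p := by
  have hne := relDifferentIdeal_ne_bot F K
  set D : Finset (HeightOneSpectrum (𝓞 K)) := T ∪ P.biUnion (placesOver K) with hDdef
  -- the relative different divisor is supported on `D`
  have hsupp : ∀ w, relDifferentDivisor F K (Sum.inr w) ≠ 0 → w ∈ D := by
    intro w hw
    haveI : w.asIdeal.IsMaximal := w.isMaximal
    rw [relDifferentDivisor, ADivisor.ofIdeal_apply_inr hne] at hw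
    by_cases hp : residueChar K w ∈ P
    · exact Finset.mem_union_right _ (Finset.mem_biUnion.mpr ⟨_, hp, mem_placesOver_residueChar w⟩)
    · by_cases hS : finBelow F K w ∈ S
      · exact Finset.mem_union_left _ ((hT w).mpr hS)
      · exact absurd (by rw [multiplicity_differentIdeal_eq_zero_of_ramificationIdx_eq_one F K w.asIdeal
          (hunr w hp hS), Nat.cast_zero]) hw
  rw [degF_eq_sum_of_subset K (relDifferentDivisor F K) D (fun w => ADivisor.ofIdeal_apply_inl _ w) hsupp,
    finrank_mul_degF_reduced_eq_sum F K S T hT, ADivisor.degF_reduced_eq_sum]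
  -- pointwise bound on `D`
  have hpt : ∀ w ∈ D, relDifferentDivisor F K (Sum.inr w) * logNorm K w ≤
      (if w ∈ T then ((pullbackWeight F K (Sum.inr w) : ℝ) - 1) * logNorm K w else 0) +
        (if residueChar K w ∈ P then
          (c (residueChar K w) : ℝ) * localDegree K w * Real.log (residueChar K w) else 0) := by
    intro w _
    haveI : w.asIdeal.IsMaximal := w.isMaximal
    rw [relDifferentDivisor, ADivisor.ofIdeal_apply_inr hne, pullbackWeight_inr_eq]
    have hl := (logNorm_pos K w).le
    have he : 1 ≤ w.asIdeal.ramificationIdx (𝓞 F) := Ideal.ramificationIdx_pos w.asIdeal (𝓞 F)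
    have hT0 : 0 ≤ (if w ∈ T then ((w.asIdeal.ramificationIdx (𝓞 F) : ℕ) - 1 : ℝ) * logNorm K w else 0) := by
      split_ifs
      · refine mul_nonneg ?_ hl
        have : (1 : ℝ) ≤ w.asIdeal.ramificationIdx (𝓞 F) := by exact_mod_cast he
        linarith
      · exact le_rfl
    by_cases hp : residueChar K w ∈ P
    · rw [if_pos hp]
      have hcast : (multiplicity w.asIdeal (differentIdeal (𝓞 F) (𝓞 K)) : ℝ) ≤
          (c (residueChar K w) : ℝ) * w.asIdeal.ramificationIdx ℤ := by exact_mod_cast hbd w hp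
      calc (multiplicity w.asIdeal (differentIdeal (𝓞 F) (𝓞 K)) : ℝ) * logNorm K w
          ≤ (c (residueChar K w) : ℝ) * w.asIdeal.ramificationIdx ℤ * logNorm K w :=
            mul_le_mul_of_nonneg_right hcast hl
        _ = (c (residueChar K w) : ℝ) * localDegree K w * Real.log (residueChar K w) := by
            rw [logNorm_eq K w, localDegree, ramIdx_eq]; push_cast; ring
        _ ≤ _ := le_add_of_nonneg_left hT0
    · rw [if_neg hp, add_zero]
      by_cases hwT : w ∈ T
      · rw [if_pos hwT]
        have h1 := multiplicity_differentIdeal_le_of_not_dvd F K w.asIdeal (htame w hp ((hT w).mp hwT))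
        have hcast : (multiplicity w.asIdeal (differentIdeal (𝓞 F) (𝓞 K)) : ℝ) ≤
            (w.asIdeal.ramificationIdx (𝓞 F) : ℝ) - 1 := by
          rw [← Nat.cast_one, ← Nat.cast_sub he]
          exact_mod_cast h1
        exact mul_le_mul_of_nonneg_right hcast hl
      · rw [if_neg hwT, multiplicity_differentIdeal_eq_zero_of_ramificationIdx_eq_one F K w.asIdeal
          (hunr w hp (fun h => hwT ((hT w).mpr h))), Nat.cast_zero, zero_mul]
  have hsum := Finset.sum_le_sum hpt
  rw [Finset.sum_add_distrib, ← Finset.sum_filter, ← Finset.sum_filter] at hsum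
  -- the `T`-part
  have hTD : D.filter (fun w => w ∈ T) = T := by
    ext w
    simp only [Finset.mem_filter, hDdef, Finset.mem_union]
    tauto
  rw [hTD] at hsum
  -- the `P`-part
  have hPD : ∑ w ∈ D.filter (fun w => residueChar K w ∈ P),
      (c (residueChar K w) : ℝ) * localDegree K w * Real.log (residueChar K w) ≤
      ∑ w ∈ P.biUnion (placesOver K),
        (c (residueChar K w) : ℝ) * localDegree K w * Real.log (residueChar K w) := by
    refine Finset.sum_le_sum_of_subset_of_nonneg (fun w hw => ?_) (fun w _ _ => ?_)
    · obtain ⟨-, hp⟩ := Finset.mem_filter.mp hw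
      exact Finset.mem_biUnion.mpr ⟨_, hp, mem_placesOver_residueChar w⟩
    · exact mul_nonneg (mul_nonneg (Nat.cast_nonneg _) (Nat.cast_nonneg _))
        (Real.log_nonneg (by exact_mod_cast (residueChar_prime K w).one_lt.le))
  have hdisj : (↑P : Set ℕ).PairwiseDisjoint (placesOver K) := by
    intro p hp q hq hne
    haveI : Fact p.Prime := ⟨hP p hp⟩
    haveI : Fact q.Prime := ⟨hP q hq⟩
    exact Finset.disjoint_left.mpr fun w hw hw' =>
      hne (((mem_placesOver_iff_residueChar w).mp hw).symm.trans ((mem_placesOver_iff_residueChar w).mp hw'))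
  have hbi : ∑ w ∈ P.biUnion (placesOver K),
      (c (residueChar K w) : ℝ) * localDegree K w * Real.log (residueChar K w) =
      (Module.finrank ℚ K : ℝ) * ∑ p ∈ P, (c p : ℝ) * Real.log p := by
    rw [Finset.sum_biUnion hdisj, Finset.mul_sum]
    refine Finset.sum_congr rfl fun p hp => ?_
    haveI : Fact p.Prime := ⟨hP p hp⟩
    have hres : ∀ w ∈ placesOver K p, residueChar K w = p := fun w hw =>
      (mem_placesOver_iff_residueChar w).mp hw
    rw [Finset.sum_congr rfl (fun w hw => by rw [hres w hw])]
    have hfund : ∑ w ∈ placesOver K p, (localDegree K w : ℝ) = Module.finrank ℚ K := by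
      exact_mod_cast sum_localDegree K p
    rw [← hfund, Finset.sum_mul]
    refine Finset.sum_congr rfl fun w _ => ?_
    ring
  -- assemble
  have hTsum : ∑ w ∈ T, ((pullbackWeight F K (Sum.inr w) : ℝ) - 1) * logNorm K w + ∑ w ∈ T, logNorm K w =
      ∑ w ∈ T, (pullbackWeight F K (Sum.inr w) : ℝ) * logNorm K w := by
    rw [← Finset.sum_add_distrib]
    refine Finset.sum_congr rfl fun w _ => ?_
    ring
  linarith

/-- **[IUTchIV] Thm. 1.10, Step (ii), second display, for real number fields** (general form): for number
fields `F ⊆ K`, bad places `S` of `F` with `T` the places of `K` over `S`, a finite set `P` of rational primes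
and `c : P → ℕ`, suppose `K/F` is unramified at the good places and tamely ramified at the bad places of
residue characteristic `∉ P` (the inputs the printed proof takes from Prop. 1.8 (vi), (vii) and (D0)), and
`ord_w 𝔡_{K/F} ≤ c(p)·e(w|p)` at the places over `p ∈ P` (the Prop. 1.3 (ii)-type input). Then
`deg(𝔡^K_ADiv) + deg(𝔣^K_ADiv) ≤ deg(𝔡^F_ADiv) + deg(𝔣^F_ADiv) + Σ_{p∈P} c(p)·log p`. Printed (p. 24):
"by applying Proposition 1.3, (i), at the primes that do not divide `2·3·5` [where we recall that the
extension `F/F_tpd` is tamely ramified over such primes — cf. Proposition 1.8, (vi), (vii)] and applying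
Proposition 1.3, (ii), … at the primes that divide `2·3·5`". The Galois form with the printed constants is
`ndeg_different_add_reduced_le_of_isGalois` / `…_F` / `…_K` below. [claim: Mochizuki2012, status: disputed] -/
theorem ndeg_different_add_reduced_le (S : Finset (HeightOneSpectrum (𝓞 F)))
    (T : Finset (HeightOneSpectrum (𝓞 K))) (hT : ∀ w, w ∈ T ↔ finBelow F K w ∈ S)
    (P : Finset ℕ) (hP : ∀ p ∈ P, p.Prime) (c : ℕ → ℕ)
    (hunr : ∀ w : HeightOneSpectrum (𝓞 K), residueChar K w ∉ P → finBelow F K w ∉ S →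
      w.asIdeal.ramificationIdx (𝓞 F) = 1)
    (htame : ∀ w : HeightOneSpectrum (𝓞 K), residueChar K w ∉ P → finBelow F K w ∈ S →
      ¬ residueChar K w ∣ w.asIdeal.ramificationIdx (𝓞 F))
    (hbd : ∀ w : HeightOneSpectrum (𝓞 K), residueChar K w ∈ P →
      multiplicity w.asIdeal (differentIdeal (𝓞 F) (𝓞 K)) ≤ c (residueChar K w) * w.asIdeal.ramificationIdx ℤ) :
    ndeg K (differentDivisor K) + ndeg K (ADivisor.reduced T) ≤
      ndeg F (differentDivisor F) + ndeg F (ADivisor.reduced S) + ∑ p ∈ P, (c p : ℝ) * Real.log p := by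
  have hF : (0 : ℝ) < Module.finrank ℚ F := by exact_mod_cast Module.finrank_pos
  have hKF : (0 : ℝ) < Module.finrank F K := by exact_mod_cast Module.finrank_pos
  have key := degF_relDifferent_add_reduced_le F K S T hT P hP c hunr htame hbd
  rw [finrank_rat_eq_mul (F := F) (K := K)] at key
  rw [ndeg_differentDivisor_tower F K, ndeg_apply F (ADivisor.reduced S), ndeg_apply K (relDifferentDivisor F K),
    ndeg_apply K (ADivisor.reduced T), finrank_rat_eq_mul (F := F) (K := K)]
  have h : degF K (relDifferentDivisor F K) / (Module.finrank F K * Module.finrank ℚ F) +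
      degF K (ADivisor.reduced T) / (Module.finrank F K * Module.finrank ℚ F) ≤
        degF F (ADivisor.reduced S) / Module.finrank ℚ F + ∑ p ∈ P, (c p : ℝ) * Real.log p := by
    rw [← add_div, div_le_iff₀ (mul_pos hKF hF)]
    calc degF K (relDifferentDivisor F K) + degF K (ADivisor.reduced T)
        ≤ Module.finrank F K * degF F (ADivisor.reduced S) +
            Module.finrank F K * Module.finrank ℚ F * ∑ p ∈ P, (c p : ℝ) * Real.log p := key
      _ = (degF F (ADivisor.reduced S) / Module.finrank ℚ F + ∑ p ∈ P, (c p : ℝ) * Real.log p) *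
            (Module.finrank F K * Module.finrank ℚ F) := by
          field_simp
  linarith

end SecondDisplay

/-! ### The Galois form and the printed constants `log(2^11·3^3·5^2)`, `2·log(l)` -/

section Galois

/-- `v_p(N) ≤ m` from `p^{m+1} ∤ N`. [cite: NeukirchANT1999, Ch. I (8.2)] -/
private theorem factorization_le_of_not_pow_dvd {p N m : ℕ} (hp : p.Prime) (hN : N ≠ 0)
    (h : ¬ p ^ (m + 1) ∣ N) : N.factorization p ≤ m := by
  by_contra hlt
  exact h ((hp.pow_dvd_iff_le_factorization hN).mpr (by omega))

/-- **[IUTchIV] Thm. 1.10, Step (ii), second display, Galois form with explicit constant**: for `K/F` a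
GALOIS extension of number fields with `[K:F] ∣ N` (`N ≠ 0`), bad places `S` of `F` (`T` = the places of `K`
over `S`), a finite set `P` of rational primes with `v_p(N) ≤ m(p)` for `p ∈ P`, and `K/F` unramified at the
good / tamely ramified at the bad places of residue characteristic `∉ P`:
`deg(𝔡^K_ADiv) + deg(𝔣^K_ADiv) ≤ deg(𝔡^F_ADiv) + deg(𝔣^F_ADiv) + Σ_{p∈P} (m(p) + 1)·log p`
— the term `m(p) + 1` is the printed "`n + 1/e₀`" of Prop. 1.3 (ii) (`ord_w 𝔡_{K/F} < e(w|p)·(v_p(N) + 1)`,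
Dedekind–Hensel), with `p^n ∣ |Gal(K/F)| ∣ N` bounding the wild part (p. 24: "the fact that we have a
natural outer inclusion `Gal(F/F_tpd) ↪ GL₂(𝔽₃) × GL₂(𝔽₅) × ℤ/2ℤ`", "`Gal(K/F) ↪ GL₂(𝔽_l)`").
[claim: Mochizuki2012, status: disputed] -/
theorem ndeg_different_add_reduced_le_of_isGalois [IsGalois F K]
    (S : Finset (HeightOneSpectrum (𝓞 F)))
    (T : Finset (HeightOneSpectrum (𝓞 K))) (hT : ∀ w, w ∈ T ↔ finBelow F K w ∈ S)
    (P : Finset ℕ) (hP : ∀ p ∈ P, p.Prime) {N : ℕ} (hN : N ≠ 0) (hdvd : Module.finrank F K ∣ N)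
    (m : ℕ → ℕ) (hm : ∀ p ∈ P, N.factorization p ≤ m p)
    (hunr : ∀ w : HeightOneSpectrum (𝓞 K), residueChar K w ∉ P → finBelow F K w ∉ S →
      w.asIdeal.ramificationIdx (𝓞 F) = 1)
    (htame : ∀ w : HeightOneSpectrum (𝓞 K), residueChar K w ∉ P → finBelow F K w ∈ S →
      ¬ residueChar K w ∣ w.asIdeal.ramificationIdx (𝓞 F)) :
    ndeg K (differentDivisor K) + ndeg K (ADivisor.reduced T) ≤
      ndeg F (differentDivisor F) + ndeg F (ADivisor.reduced S) + ∑ p ∈ P, ((m p + 1 : ℕ) : ℝ) * Real.log p := by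
  refine ndeg_different_add_reduced_le F K S T hT P hP (fun p => m p + 1) hunr htame fun w hp => ?_
  haveI : w.asIdeal.IsMaximal := w.isMaximal
  have h1 := multiplicity_differentIdeal_lt_of_isGalois F K w.asIdeal hN hdvd
  have h2 : N.factorization (residueChar K w) + 1 ≤ m (residueChar K w) + 1 :=
    Nat.succ_le_succ (hm _ hp)
  have h3 := Nat.mul_le_mul_left (w.asIdeal.ramificationIdx ℤ) h2
  have : multiplicity w.asIdeal (differentIdeal (𝓞 F) (𝓞 K)) + 1 ≤
      (m (residueChar K w) + 1) * w.asIdeal.ramificationIdx ℤ := by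
    rw [mul_comm]; exact h1.trans h3
  omega

/-- **Step (ii), second display for `F/F_tpd` with the printed constant**: for a Galois extension `K/F` of
number fields with `[K:F] ∣ 2^10·3^2·5 = |GL₂(𝔽₃)|·|GL₂(𝔽₅)|·|ℤ/2ℤ|` ((E3), (E4)), unramified at the good and
tamely ramified at the bad places of residue characteristic `∤ 2·3·5`:
`deg(𝔡^K_ADiv) + deg(𝔣^K_ADiv) ≤ deg(𝔡^F_ADiv) + deg(𝔣^F_ADiv) + log(2^11·3^3·5^2)` — the printed
"`log(𝔡^F) + log(𝔣^F) ≤ log(𝔡^{F_tpd}) + log(𝔣^{F_tpd}) + log(2^11·3^3·5^2)`" (p. 24) for ACTUAL number fields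
`F_tpd ⊆ F` (here named `F ⊆ K`), i.e. the field `F_le` of `Thm110Numerics.ProofData`; the remaining inputs —
that `F/F_tpd` is Galois with group inside `GL₂(𝔽₃) × GL₂(𝔽₅) × ℤ/2ℤ` and the Prop. 1.8 (vi)(vii)/(D0)
ramification facts — are the hypotheses. [claim: Mochizuki2012, status: disputed] -/
theorem ndeg_different_add_reduced_le_F [IsGalois F K]
    (S : Finset (HeightOneSpectrum (𝓞 F)))
    (T : Finset (HeightOneSpectrum (𝓞 K))) (hT : ∀ w, w ∈ T ↔ finBelow F K w ∈ S)
    (hdvd : Module.finrank F K ∣ 2 ^ 10 * 3 ^ 2 * 5)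
    (hunr : ∀ w : HeightOneSpectrum (𝓞 K), residueChar K w ∉ ({2, 3, 5} : Finset ℕ) → finBelow F K w ∉ S →
      w.asIdeal.ramificationIdx (𝓞 F) = 1)
    (htame : ∀ w : HeightOneSpectrum (𝓞 K), residueChar K w ∉ ({2, 3, 5} : Finset ℕ) → finBelow F K w ∈ S →
      ¬ residueChar K w ∣ w.asIdeal.ramificationIdx (𝓞 F)) :
    ndeg K (differentDivisor K) + ndeg K (ADivisor.reduced T) ≤
      ndeg F (differentDivisor F) + ndeg F (ADivisor.reduced S) + Real.log (2 ^ 11 * 3 ^ 3 * 5 ^ 2) := by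
  have hP : ∀ p ∈ ({2, 3, 5} : Finset ℕ), p.Prime := by
    intro p hp
    simp only [Finset.mem_insert, Finset.mem_singleton] at hp
    rcases hp with rfl | rfl | rfl <;> norm_num
  have hN : (2 ^ 10 * 3 ^ 2 * 5 : ℕ) ≠ 0 := by norm_num
  let m : ℕ → ℕ := fun p => if p = 2 then 10 else if p = 3 then 2 else 1
  have hm : ∀ p ∈ ({2, 3, 5} : Finset ℕ), (2 ^ 10 * 3 ^ 2 * 5 : ℕ).factorization p ≤ m p := by
    intro p hp
    simp only [Finset.mem_insert, Finset.mem_singleton] at hp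
    rcases hp with rfl | rfl | rfl
    · exact factorization_le_of_not_pow_dvd Nat.prime_two hN (by decide)
    · exact factorization_le_of_not_pow_dvd Nat.prime_three hN (by decide)
    · exact factorization_le_of_not_pow_dvd (by norm_num) hN (by decide)
  have h := ndeg_different_add_reduced_le_of_isGalois F K S T hT {2, 3, 5} hP hN hdvd m hm hunr htame
  have hsum : ∑ p ∈ ({2, 3, 5} : Finset ℕ), ((m p + 1 : ℕ) : ℝ) * Real.log p =
      Real.log (2 ^ 11 * 3 ^ 3 * 5 ^ 2) := by
    rw [← Thm110StepII.PlaceData.log_F_const.2, Finset.sum_insert (by decide), Finset.sum_insert (by decide),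
      Finset.sum_singleton]
    simp only [m]
    push_cast
    ring
  rwa [hsum] at h

/-- **Step (ii), third display for `K/F` with the printed constant**: for a Galois extension `K/F` of number
fields with `[K:F] ∣ l(l+1)(l-1)² = |GL₂(𝔽_l)|` (`l ≥ 5` prime), unramified at the good and tamely ramified
at the bad places of residue characteristic `≠ l`:
`deg(𝔡^K_ADiv) + deg(𝔣^K_ADiv) ≤ deg(𝔡^F_ADiv) + deg(𝔣^F_ADiv) + 2·log(l)` — the printed "since the extension
`K/F` is tamely ramified at the primes that do not divide `l`, and we have a natural outer inclusion
`Gal(K/F) ↪ GL₂(𝔽_l)`, the inequality `log(𝔡^K) ≤ log(𝔡^K) + log(𝔣^K) ≤ log(𝔡^F) + log(𝔣^F) + 2·log(l)`"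
(p. 24), i.e. the field `K_le` of `Thm110Numerics.ProofData`, for ACTUAL number fields.
[claim: Mochizuki2012, status: disputed] -/
theorem ndeg_different_add_reduced_le_K [IsGalois F K] {l : ℕ} (hl : l.Prime) (h5 : 5 ≤ l)
    (S : Finset (HeightOneSpectrum (𝓞 F)))
    (T : Finset (HeightOneSpectrum (𝓞 K))) (hT : ∀ w, w ∈ T ↔ finBelow F K w ∈ S)
    (hdvd : Module.finrank F K ∣ l * (l + 1) * (l - 1) ^ 2)
    (hunr : ∀ w : HeightOneSpectrum (𝓞 K), residueChar K w ≠ l → finBelow F K w ∉ S →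
      w.asIdeal.ramificationIdx (𝓞 F) = 1)
    (htame : ∀ w : HeightOneSpectrum (𝓞 K), residueChar K w ≠ l → finBelow F K w ∈ S →
      ¬ residueChar K w ∣ w.asIdeal.ramificationIdx (𝓞 F)) :
    ndeg K (differentDivisor K) + ndeg K (ADivisor.reduced T) ≤
      ndeg F (differentDivisor F) + ndeg F (ADivisor.reduced S) + 2 * Real.log l := by
  have hP : ∀ p ∈ ({l} : Finset ℕ), p.Prime := fun p hp => by
    rw [Finset.mem_singleton] at hp; exact hp ▸ hl
  have hN : l * (l + 1) * (l - 1) ^ 2 ≠ 0 :=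
    Nat.mul_ne_zero (Nat.mul_ne_zero hl.ne_zero (Nat.succ_ne_zero l)) (pow_ne_zero 2 (by omega))
  have hm : ∀ p ∈ ({l} : Finset ℕ), (l * (l + 1) * (l - 1) ^ 2).factorization p ≤ 1 := by
    intro p hp
    rw [Finset.mem_singleton] at hp
    subst hp
    exact factorization_le_of_not_pow_dvd hl hN (Thm110StepII.PlaceData.GL2_card_l_part p hl h5).2
  have h := ndeg_different_add_reduced_le_of_isGalois F K S T hT {l} hP hN hdvd (fun _ => 1) hm
    (fun w hw => hunr w (by simpa using hw)) (fun w hw => htame w (by simpa using hw))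
  rw [Finset.sum_singleton] at h
  norm_num at h
  linarith

/-- `ndeg_different_add_reduced_le_F` with the degree hypothesis in the DIVISION-FIELD shape
`[K:F] ∣ 2·(|GL₂(𝔽₃)|·|GL₂(𝔽₅)|)`, `|GL₂(𝔽_p)| = p·(p−1)²·(p+1)` (the tree's
`WeierstrassCurve.finrank_dvd_of_ker_inf_ker_le_fixingSubgroup` for `L ⊆ F(E[3], E[5])`, times `2` for
`√−1`): the printed "`Gal(F/F_tpd) ↪ GL₂(𝔽₃) × GL₂(𝔽₅) × ℤ/2ℤ`" (p. 24).
[claim: Mochizuki2012, status: disputed] -/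
theorem ndeg_different_add_reduced_le_F' [IsGalois F K]
    (S : Finset (HeightOneSpectrum (𝓞 F)))
    (T : Finset (HeightOneSpectrum (𝓞 K))) (hT : ∀ w, w ∈ T ↔ finBelow F K w ∈ S)
    (hdvd : Module.finrank F K ∣ 2 * ((3 * (3 - 1) ^ 2 * (3 + 1)) * (5 * (5 - 1) ^ 2 * (5 + 1))))
    (hunr : ∀ w : HeightOneSpectrum (𝓞 K), residueChar K w ∉ ({2, 3, 5} : Finset ℕ) → finBelow F K w ∉ S →
      w.asIdeal.ramificationIdx (𝓞 F) = 1)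
    (htame : ∀ w : HeightOneSpectrum (𝓞 K), residueChar K w ∉ ({2, 3, 5} : Finset ℕ) → finBelow F K w ∈ S →
      ¬ residueChar K w ∣ w.asIdeal.ramificationIdx (𝓞 F)) :
    ndeg K (differentDivisor K) + ndeg K (ADivisor.reduced T) ≤
      ndeg F (differentDivisor F) + ndeg F (ADivisor.reduced S) + Real.log (2 ^ 11 * 3 ^ 3 * 5 ^ 2) :=
  ndeg_different_add_reduced_le_F F K S T hT (by norm_num at hdvd ⊢; exact hdvd) hunr htame

/-- `ndeg_different_add_reduced_le_K` with the degree hypothesis in the DIVISION-FIELD shape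
`[K:F] ∣ l·(l−1)²·(l+1) = |GL₂(𝔽_l)|` (the tree's `WeierstrassCurve.finrank_dvd_of_ker_galoisRepTorsion_le_fixingSubgroup`
for `K ⊆ F(E[l])`): the printed "`Gal(K/F) ↪ GL₂(𝔽_l)`" (p. 24). [claim: Mochizuki2012, status: disputed] -/
theorem ndeg_different_add_reduced_le_K' [IsGalois F K] {l : ℕ} (hl : l.Prime) (h5 : 5 ≤ l)
    (S : Finset (HeightOneSpectrum (𝓞 F)))
    (T : Finset (HeightOneSpectrum (𝓞 K))) (hT : ∀ w, w ∈ T ↔ finBelow F K w ∈ S)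
    (hdvd : Module.finrank F K ∣ l * (l - 1) ^ 2 * (l + 1))
    (hunr : ∀ w : HeightOneSpectrum (𝓞 K), residueChar K w ≠ l → finBelow F K w ∉ S →
      w.asIdeal.ramificationIdx (𝓞 F) = 1)
    (htame : ∀ w : HeightOneSpectrum (𝓞 K), residueChar K w ≠ l → finBelow F K w ∈ S →
      ¬ residueChar K w ∣ w.asIdeal.ramificationIdx (𝓞 F)) :
    ndeg K (differentDivisor K) + ndeg K (ADivisor.reduced T) ≤
      ndeg F (differentDivisor F) + ndeg F (ADivisor.reduced S) + 2 * Real.log l :=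
  ndeg_different_add_reduced_le_K F K hl h5 S T hT (by rwa [mul_right_comm] at hdvd) hunr htame

end Galois

end Literature.IUT.LogVolume

end
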